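import Literature.Geometry.Kaehler.OrthoChartEstimates
import Mathlib.Analysis.SpecialFunctions.SmoothTransition
import Mathlib.Analysis.InnerProductSpace.Calculus

/-!
# The collapse map of a chart window

Let `K ⊆ V` be a complex subspace, `P = P_K` the orthogonal projection, `m ∈ V`, and `Ψ : K → V`
holomorphic on `ball 0 ρ` with `P(Ψ k − m) = k` (an orthogonally normalised chart of an analytic
set `F` at `m`, `HolomorphicChain.exists_orthoChart`). A **chart window** (`ChartWindow`) fixes
radii `0 < a₃ < a₂ < a₁ < ρ` and a vertical width `τ > 0`. In the coordinates
`k(x) = P(x − m) ∈ K` and `w(x) = x − Ψ(k(x))` (the displacement from the graph point with the same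
`K`-coordinate; `w(x) ⊥ K`) its **collapse map** is

`h(x) = x − λ(x) κ(x) w(x)`, `λ = σ((a₁² − ‖k‖²)/(a₁² − a₂²))`, `κ = σ((τ² − ‖w‖²)/(3τ²/4))`,

`σ = Real.smoothTransition`. Main facts:

* `ChartWindow.contDiff_collapse` — `h` is `C^∞` (the displacement is cut off inside the chart
  domain; `contDiff_smul_of_tsupport_subset`);
* `ChartWindow.kf_collapse` — **`k ∘ h = k`** (`w ⊥ K`);
* `ChartWindow.collapse_eq_self_of_…` — `h = id` where `‖k‖ ≥ a₁` or `‖w‖ ≥ τ`, and on the graph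
  `{x = Ψ(k x)}`; `ChartWindow.collapse_eq_chart` — **`h(x) = Ψ(k x)` on the core**
  `{‖k‖ ≤ a₂, ‖w‖ ≤ τ/2}`; `ChartWindow.norm_collapse_sub_le` — `‖h x − x‖ ≤ ‖w x‖ ≤ τ` on the tube.

These windows realise, one chart at a time, the retraction of the blow-ups of a holomorphic chain
onto its tangent cone (King's tangent cone theorem, `Literature.Geometry.Kaehler.King1971_tangentCone`).

Definitions with bodies + theorems; no named facts.

## References

* H. Federer, *Geometric Measure Theory*, Springer 1969, 4.1.9, 4.3.16–4.3.18 [Federer1969].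
* J. R. King, *The currents defined by analytic varieties*, Acta Math. 127 (1971), §5.
-/

noncomputable section

open scoped Topology ContDiff
open Set Filter Metric Function Module TopologicalSpace Real

namespace Literature.Geometry.Kaehler

/-! ### Zero extensions of cut-off smooth maps -/

section ZeroExtension

variable {E : Type*} [NormedAddCommGroup E] [NormedSpace ℝ E]
  {F : Type*} [NormedAddCommGroup F] [NormedSpace ℝ F]

/-- **A cut-off product is globally smooth**: if `φ : E → ℝ` is `Cⁿ` with `tsupport φ ⊆ U`,
`U` open, and `G : E → F` is `Cⁿ` on `U`, then `x ↦ φ x • G x` is `Cⁿ` on all of `E` (whatever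
`G` is off `U`). (A private copy, for general `n`, of the lemma of the same name in
`TorusTransferOps.lean`, to keep the imports of this file light.) [folklore] -/
private theorem contDiff_smul_of_tsupport_subset_aux {n : WithTop ℕ∞} {φ : E → ℝ} {G : E → F} {U : Set E}
    (hU : IsOpen U) (hφ : ContDiff ℝ n φ) (hφU : tsupport φ ⊆ U) (hG : ContDiffOn ℝ n G U) :
    ContDiff ℝ n fun x => φ x • G x := by
  rw [contDiff_iff_contDiffAt]
  intro x
  by_cases hx : x ∈ U
  · exact hφ.contDiffAt.smul (hG.contDiffAt (hU.mem_nhds hx))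
  · have hx' : x ∉ tsupport φ := fun h => hx (hφU h)
    have h0 : (fun x => φ x • G x) =ᶠ[𝓝 x] fun _ => 0 := by
      have : φ =ᶠ[𝓝 x] 0 := notMem_tsupport_iff_eventuallyEq.1 hx'
      filter_upwards [this] with y hy
      rw [hy, Pi.zero_apply, zero_smul]
    exact (contDiffAt_const (c := (0 : F))).congr_of_eventuallyEq h0

end ZeroExtension

/-! ### Chart windows -/

universe u

variable {V : Type u} [NormedAddCommGroup V] [InnerProductSpace ℂ V] [FiniteDimensional ℂ V]

/-- **A chart window**: an orthogonally normalised holomorphic chart `Ψ` over the complex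
subspace `K` centred at `m`, with window radii `a₃ < a₂ < a₁ < ρ` and vertical width `τ`.
[cite: Federer1969, 4.3.18; King 1971, §5] -/
structure ChartWindow (V : Type u) [NormedAddCommGroup V] [InnerProductSpace ℂ V]
    [FiniteDimensional ℂ V] where
  /-- The tangent plane. -/
  K : Submodule ℂ V
  /-- The centre. -/
  m : V
  /-- The chart. -/
  Ψ : K → V
  /-- The chart radius. -/
  ρ : ℝ
  /-- The lateral radius of the tube. -/
  a₁ : ℝ
  /-- The radius up to which the lateral cutoff is `1`. -/
  a₂ : ℝ
  /-- The radius of the inner core. -/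
  a₃ : ℝ
  /-- The vertical width of the tube. -/
  τ : ℝ
  a₃_pos : 0 < a₃
  a₃_lt : a₃ < a₂
  a₂_lt : a₂ < a₁
  a₁_lt : a₁ < ρ
  τ_pos : 0 < τ
  differentiableOn : DifferentiableOn ℂ Ψ (ball 0 ρ)
  proj_eq : ∀ k ∈ ball (0 : K) ρ, K.orthogonalProjectionOnto (Ψ k - m) = k

namespace ChartWindow

variable (W : ChartWindow V)

/-- `0 < a₂`. [folklore] -/
theorem a₂_pos : 0 < W.a₂ := W.a₃_pos.trans W.a₃_lt

/-- `0 < a₁`. [folklore] -/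
theorem a₁_pos : 0 < W.a₁ := W.a₂_pos.trans W.a₂_lt

/-- `0 < ρ`. [folklore] -/
theorem ρ_pos : 0 < W.ρ := W.a₁_pos.trans W.a₁_lt

/-- The `K`-coordinate `k(x) = P_K(x − m)`. [folklore] -/
def kf (x : V) : W.K := W.K.orthogonalProjectionOnto (x - W.m)

/-- The vertical displacement `w(x) = x − Ψ(k x)` from the graph. [folklore] -/
def wf (x : V) : V := x - W.Ψ (W.kf x)

/-- The lateral cutoff `λ(x) = σ((a₁² − ‖k x‖²)/(a₁² − a₂²))`. [folklore] -/
def lam (x : V) : ℝ := smoothTransition ((W.a₁ ^ 2 - ‖W.kf x‖ ^ 2) / (W.a₁ ^ 2 - W.a₂ ^ 2))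

/-- The vertical cutoff `κ(x) = σ((τ² − ‖w x‖²)/(3τ²/4))`. [folklore] -/
def kap (x : V) : ℝ := smoothTransition ((W.τ ^ 2 - ‖W.wf x‖ ^ 2) / (3 * W.τ ^ 2 / 4))

/-- The displacement `λ κ w`. [folklore] -/
def disp (x : V) : V := W.lam x • (W.kap x • W.wf x)

/-- **The collapse map `h(x) = x − λ(x) κ(x) w(x)`.** [cite: Federer1969, 4.3.18; King 1971, §5] -/
def collapse (x : V) : V := x - W.disp x

/-! #### The cutoffs -/

/-- `0 ≤ λ`. [folklore] -/
theorem lam_nonneg (x : V) : 0 ≤ W.lam x := smoothTransition.nonneg _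

/-- `λ ≤ 1`. [folklore] -/
theorem lam_le_one (x : V) : W.lam x ≤ 1 := smoothTransition.le_one _

/-- `0 ≤ κ`. [folklore] -/
theorem kap_nonneg (x : V) : 0 ≤ W.kap x := smoothTransition.nonneg _

/-- `κ ≤ 1`. [folklore] -/
theorem kap_le_one (x : V) : W.kap x ≤ 1 := smoothTransition.le_one _

/-- `λ = 0` outside the lateral radius `a₁`. [folklore] -/
theorem lam_eq_zero {x : V} (hx : W.a₁ ≤ ‖W.kf x‖) : W.lam x = 0 := by
  refine smoothTransition.zero_of_nonpos (div_nonpos_of_nonpos_of_nonneg ?_ ?_)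
  · nlinarith [W.a₁_pos, norm_nonneg (W.kf x)]
  · nlinarith [W.a₂_lt, W.a₂_pos]

/-- `λ = 1` inside the radius `a₂`. [folklore] -/
theorem lam_eq_one {x : V} (hx : ‖W.kf x‖ ≤ W.a₂) : W.lam x = 1 := by
  refine smoothTransition.one_of_one_le ?_
  rw [le_div_iff₀ (by nlinarith [W.a₂_lt, W.a₂_pos]), one_mul]
  nlinarith [norm_nonneg (W.kf x), W.a₂_pos]

/-- `κ = 0` outside the vertical width `τ`. [folklore] -/
theorem kap_eq_zero {x : V} (hx : W.τ ≤ ‖W.wf x‖) : W.kap x = 0 := by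
  refine smoothTransition.zero_of_nonpos (div_nonpos_of_nonpos_of_nonneg ?_ ?_)
  · nlinarith [W.τ_pos, norm_nonneg (W.wf x)]
  · nlinarith [W.τ_pos]

/-- `κ = 1` within vertical distance `τ/2`. [folklore] -/
theorem kap_eq_one {x : V} (hx : ‖W.wf x‖ ≤ W.τ / 2) : W.kap x = 1 := by
  refine smoothTransition.one_of_one_le ?_
  rw [le_div_iff₀ (by nlinarith [W.τ_pos]), one_mul]
  nlinarith [norm_nonneg (W.wf x), W.τ_pos]

/-- `tsupport λ ⊆ {‖k‖ ≤ a₁}`. [folklore] -/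
theorem tsupport_lam_subset : tsupport W.lam ⊆ {x | ‖W.kf x‖ ≤ W.a₁} := by
  refine closure_minimal ?_ (isClosed_le (continuous_norm.comp ?_) continuous_const)
  · intro x hx
    by_contra h
    simp only [mem_setOf_eq, not_le] at h
    exact hx (W.lam_eq_zero h.le)
  · exact (W.K.orthogonalProjectionOnto.continuous).comp (continuous_id.sub continuous_const)

/-! #### Algebra of the collapse -/

/-- **`w ⊥ K`**: `P_K(w x) = 0` inside the chart domain. [folklore] -/
theorem proj_wf {x : V} (hx : ‖W.kf x‖ < W.ρ) : W.K.orthogonalProjectionOnto (W.wf x) = 0 := by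
  have h := W.proj_eq (W.kf x) (mem_ball_zero_iff.2 hx)
  have : W.wf x = (x - W.m) - (W.Ψ (W.kf x) - W.m) := by simp [wf]
  rw [this, map_sub, h]
  simp [kf]

/-- **`k ∘ h = k`.** [cite: Federer1969, 4.3.18] -/
theorem kf_collapse (x : V) : W.kf (W.collapse x) = W.kf x := by
  by_cases hx : ‖W.kf x‖ < W.ρ
  · have hw := W.proj_wf hx
    have h1 : W.collapse x - W.m = (x - W.m) - ((W.lam x * W.kap x : ℝ) : ℂ) • W.wf x := by
      simp only [collapse, disp, smul_smul, Complex.coe_smul]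
      abel
    simp only [kf] at hw ⊢
    rw [h1, map_sub, map_smul, hw, smul_zero, sub_zero]
  · have hlam : W.lam x = 0 := W.lam_eq_zero (le_of_lt (W.a₁_lt.trans_le (not_lt.1 hx)))
    simp [collapse, disp, hlam]

/-- `h x − x = −λ κ w`, so `‖h x − x‖ ≤ ‖w x‖`. [folklore] -/
theorem norm_collapse_sub_le_norm_wf (x : V) : ‖W.collapse x - x‖ ≤ ‖W.wf x‖ := by
  simp only [collapse, disp, sub_sub_cancel_left, norm_neg, norm_smul, Real.norm_eq_abs,
    abs_of_nonneg (W.lam_nonneg x), abs_of_nonneg (W.kap_nonneg x)]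
  calc W.lam x * (W.kap x * ‖W.wf x‖) ≤ 1 * (1 * ‖W.wf x‖) := by
        gcongr
        · exact mul_nonneg (W.kap_nonneg x) (norm_nonneg _)
        · exact W.lam_le_one x
        · exact W.kap_le_one x
    _ = ‖W.wf x‖ := by ring

/-- **`‖h x − x‖ ≤ τ`.** [cite: Federer1969, 4.3.18] -/
theorem norm_collapse_sub_le (x : V) : ‖W.collapse x - x‖ ≤ W.τ := by
  by_cases hw : ‖W.wf x‖ < W.τ
  · exact (W.norm_collapse_sub_le_norm_wf x).trans hw.le
  · have hk : W.kap x = 0 := W.kap_eq_zero (not_lt.1 hw)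
    simp [collapse, disp, hk, W.τ_pos.le]

/-- **`h = id` off the tube**: if `‖k x‖ ≥ a₁` or `‖w x‖ ≥ τ`. [folklore] -/
theorem collapse_eq_self_of_le {x : V} (hx : W.a₁ ≤ ‖W.kf x‖ ∨ W.τ ≤ ‖W.wf x‖) :
    W.collapse x = x := by
  rcases hx with h | h
  · simp [collapse, disp, W.lam_eq_zero h]
  · simp [collapse, disp, W.kap_eq_zero h]

/-- **`h = Ψ ∘ k` on the core** `{‖k‖ ≤ a₂, ‖w‖ ≤ τ/2}`. [cite: Federer1969, 4.3.18] -/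
theorem collapse_eq_chart {x : V} (hk : ‖W.kf x‖ ≤ W.a₂) (hw : ‖W.wf x‖ ≤ W.τ / 2) :
    W.collapse x = W.Ψ (W.kf x) := by
  simp [collapse, disp, W.lam_eq_one hk, W.kap_eq_one hw, wf]

/-- **`h = id` on the graph** `{x = Ψ(k x)}`. [folklore] -/
theorem collapse_eq_self_of_eq_chart {x : V} (hx : x = W.Ψ (W.kf x)) : W.collapse x = x := by
  have : W.wf x = 0 := by rw [wf, ← hx, sub_self]
  simp [collapse, disp, this]

/-- The vertical displacement after the collapse: `w(h x) = (1 − λκ) w(x)`. [folklore] -/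
theorem wf_collapse (x : V) : W.wf (W.collapse x) = (1 - W.lam x * W.kap x) • W.wf x := by
  have hk := W.kf_collapse x
  simp only [wf, hk]
  simp only [collapse, disp, sub_smul, one_smul, smul_smul, wf]
  abel

/-- **The collapse does not increase the vertical displacement**: `‖w(h x)‖ ≤ ‖w x‖`. [folklore] -/
theorem norm_wf_collapse_le (x : V) : ‖W.wf (W.collapse x)‖ ≤ ‖W.wf x‖ := by
  rw [W.wf_collapse, norm_smul, Real.norm_eq_abs]
  have h1 : 0 ≤ 1 - W.lam x * W.kap x := by
    nlinarith [W.lam_nonneg x, W.kap_nonneg x, W.lam_le_one x, W.kap_le_one x]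
  have h2 : 1 - W.lam x * W.kap x ≤ 1 := by nlinarith [W.lam_nonneg x, W.kap_nonneg x]
  rw [abs_of_nonneg h1]
  exact (mul_le_of_le_one_left (norm_nonneg _) h2)

/-! #### Smoothness -/

/-- `k` is smooth (affine). [folklore] -/
theorem contDiff_kf : ContDiff ℝ ∞ W.kf :=
  ((W.K.orthogonalProjectionOnto.restrictScalars ℝ).contDiff).comp (contDiff_id.sub contDiff_const)

/-- `λ` is smooth. [folklore] -/
theorem contDiff_lam : ContDiff ℝ ∞ W.lam := by
  have h1 : ContDiff ℝ ∞ fun x => ‖W.kf x‖ ^ 2 := W.contDiff_kf.norm_sq (𝕜 := ℂ)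
  exact smoothTransition.contDiff.comp ((contDiff_const.sub h1).div_const _)

/-- `w` is smooth on the chart domain `{‖k‖ < ρ}`. [folklore] -/
theorem contDiffOn_wf : ContDiffOn ℝ ∞ W.wf {x | ‖W.kf x‖ < W.ρ} := by
  have han := Literature.Analysis.Complex.SCV.analyticOnNhd_of_differentiableOn W.differentiableOn
    isOpen_ball
  have hΨ : ContDiffOn ℝ ∞ W.Ψ (ball 0 W.ρ) :=
    ((han.contDiffOn (n := ∞) isOpen_ball.uniqueDiffOn).restrict_scalars ℝ)
  refine contDiffOn_id.sub (hΨ.comp W.contDiff_kf.contDiffOn fun x hx => ?_)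
  exact mem_ball_zero_iff.2 hx

/-- The chart domain `{‖k‖ < ρ}` is open. [folklore] -/
theorem isOpen_chartDomain : IsOpen {x : V | ‖W.kf x‖ < W.ρ} :=
  isOpen_lt (continuous_norm.comp W.contDiff_kf.continuous) continuous_const

/-- `κ • w` is smooth on the chart domain. [folklore] -/
theorem contDiffOn_kap_smul_wf : ContDiffOn ℝ ∞ (fun x => W.kap x • W.wf x) {x | ‖W.kf x‖ < W.ρ} := by
  have hw := W.contDiffOn_wf
  have h1 : ContDiffOn ℝ ∞ (fun x => ‖W.wf x‖ ^ 2) {x | ‖W.kf x‖ < W.ρ} := hw.norm_sq (𝕜 := ℂ)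
  have hk : ContDiffOn ℝ ∞ W.kap {x | ‖W.kf x‖ < W.ρ} :=
    smoothTransition.contDiff.comp_contDiffOn ((contDiffOn_const.sub h1).div_const _)
  exact hk.smul hw

/-- **The collapse map is smooth.** [cite: Federer1969, 4.3.18] -/
theorem contDiff_collapse : ContDiff ℝ ∞ W.collapse := by
  have hdisp : ContDiff ℝ ∞ W.disp :=
    contDiff_smul_of_tsupport_subset_aux W.isOpen_chartDomain W.contDiff_lam
      (W.tsupport_lam_subset.trans fun x hx => lt_of_le_of_lt hx W.a₁_lt) W.contDiffOn_kap_smul_wf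
  exact contDiff_id.sub hdisp

/-- The collapse map is continuous. [folklore] -/
theorem continuous_collapse : Continuous W.collapse := W.contDiff_collapse.continuous

/-! #### The regions -/

/-- The open tube `{‖k‖ < a₁, ‖w‖ < τ}` outside which `h = id`. [folklore] -/
def tube : Set V := {x | ‖W.kf x‖ < W.a₁ ∧ ‖W.wf x‖ < W.τ}

/-- The closed core `{‖k‖ ≤ a₂, ‖w‖ ≤ τ/2}` on which `h = Ψ ∘ k`. [folklore] -/
def core : Set V := {x | ‖W.kf x‖ ≤ W.a₂ ∧ ‖W.wf x‖ ≤ W.τ / 2}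

/-- The open inner core `{‖k‖ < a₃, ‖w‖ < τ/4}`. [folklore] -/
def innerCore : Set V := {x | ‖W.kf x‖ < W.a₃ ∧ ‖W.wf x‖ < W.τ / 4}

/-- Membership in the tube. [folklore] -/
theorem mem_tube_iff {x : V} : x ∈ W.tube ↔ ‖W.kf x‖ < W.a₁ ∧ ‖W.wf x‖ < W.τ := Iff.rfl

/-- Membership in the core. [folklore] -/
theorem mem_core_iff {x : V} : x ∈ W.core ↔ ‖W.kf x‖ ≤ W.a₂ ∧ ‖W.wf x‖ ≤ W.τ / 2 := Iff.rfl

/-- Membership in the inner core. [folklore] -/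
theorem mem_innerCore_iff {x : V} : x ∈ W.innerCore ↔ ‖W.kf x‖ < W.a₃ ∧ ‖W.wf x‖ < W.τ / 4 :=
  Iff.rfl

/-- `innerCore ⊆ core ⊆ tube`. [folklore] -/
theorem innerCore_subset_core : W.innerCore ⊆ W.core := fun x hx =>
  ⟨(hx.1.trans W.a₃_lt).le, by linarith [hx.2, W.τ_pos]⟩

/-- `core ⊆ tube`. [folklore] -/
theorem core_subset_tube : W.core ⊆ W.tube := fun x hx =>
  ⟨lt_of_le_of_lt hx.1 W.a₂_lt, by linarith [hx.2, W.τ_pos]⟩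

/-- `h = id` off the tube. [folklore] -/
theorem collapse_eq_self_of_notMem_tube {x : V} (hx : x ∉ W.tube) : W.collapse x = x := by
  rw [mem_tube_iff, not_and_or, not_lt, not_lt] at hx
  exact W.collapse_eq_self_of_le hx

/-- `h = Ψ ∘ k` on the core. [folklore] -/
theorem collapse_eq_chart_of_mem_core {x : V} (hx : x ∈ W.core) : W.collapse x = W.Ψ (W.kf x) :=
  W.collapse_eq_chart hx.1 hx.2

/-- The tube is open. [folklore] -/
theorem isOpen_tube : IsOpen W.tube := by
  have h1 : IsOpen {x : V | ‖W.kf x‖ < W.a₁} :=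
    isOpen_lt (continuous_norm.comp W.contDiff_kf.continuous) continuous_const
  have h2 : IsOpen ({x : V | ‖W.kf x‖ < W.ρ} ∩ W.wf ⁻¹' ball 0 W.τ) :=
    W.contDiffOn_wf.continuousOn.isOpen_inter_preimage W.isOpen_chartDomain isOpen_ball
  have : W.tube = {x : V | ‖W.kf x‖ < W.a₁} ∩ ({x : V | ‖W.kf x‖ < W.ρ} ∩ W.wf ⁻¹' ball 0 W.τ) := by
    ext x
    simp only [tube, mem_setOf_eq, mem_inter_iff, mem_preimage, mem_ball_zero_iff]
    exact ⟨fun ⟨h1, h2⟩ => ⟨h1, h1.trans W.a₁_lt, h2⟩, fun ⟨h1, _, h2⟩ => ⟨h1, h2⟩⟩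
  rw [this]
  exact h1.inter h2

/-- The inner core is open. [folklore] -/
theorem isOpen_innerCore : IsOpen W.innerCore := by
  have h1 : IsOpen {x : V | ‖W.kf x‖ < W.a₃} :=
    isOpen_lt (continuous_norm.comp W.contDiff_kf.continuous) continuous_const
  have h2 : IsOpen ({x : V | ‖W.kf x‖ < W.ρ} ∩ W.wf ⁻¹' ball 0 (W.τ / 4)) :=
    W.contDiffOn_wf.continuousOn.isOpen_inter_preimage W.isOpen_chartDomain isOpen_ball
  have hρ : W.a₃ < W.ρ := W.a₃_lt.trans (W.a₂_lt.trans W.a₁_lt)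
  have : W.innerCore = {x : V | ‖W.kf x‖ < W.a₃} ∩
      ({x : V | ‖W.kf x‖ < W.ρ} ∩ W.wf ⁻¹' ball 0 (W.τ / 4)) := by
    ext x
    simp only [innerCore, mem_setOf_eq, mem_inter_iff, mem_preimage, mem_ball_zero_iff]
    exact ⟨fun ⟨h1, h2⟩ => ⟨h1, h1.trans hρ, h2⟩, fun ⟨h1, _, h2⟩ => ⟨h1, h2⟩⟩
  rw [this]
  exact h1.inter h2

/-- The tube lies in the chart domain. [folklore] -/
theorem norm_kf_lt_of_mem_tube {x : V} (hx : x ∈ W.tube) : ‖W.kf x‖ < W.ρ := hx.1.trans W.a₁_lt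

/-- **The collapse maps the tube into the tube** (same `k`, smaller `‖w‖`). [folklore] -/
theorem collapse_mem_tube {x : V} (hx : x ∈ W.tube) : W.collapse x ∈ W.tube :=
  ⟨by rw [W.kf_collapse]; exact hx.1, (W.norm_wf_collapse_le x).trans_lt hx.2⟩

/-- **Points of the graph near the centre**: if `x = Ψ k` with `‖k‖ < ρ` then `k = k(x)` and
`w(x) = 0`. [folklore] -/
theorem kf_chart {k : W.K} (hk : k ∈ ball (0 : W.K) W.ρ) : W.kf (W.Ψ k) = k := by
  simp only [kf]
  exact W.proj_eq k hk

/-- Graph points have zero vertical displacement. [folklore] -/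
theorem wf_chart {k : W.K} (hk : k ∈ ball (0 : W.K) W.ρ) : W.wf (W.Ψ k) = 0 := by
  rw [wf, W.kf_chart hk, sub_self]

end ChartWindow

end Literature.Geometry.Kaehler
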